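import Literature.NumberTheory.GaloisRepresentations.HeckeCharacter
import HarnessLib

/-!
# Norm twists are unramified everywhere (proof file)

Sibling proof file of `Literature/NumberTheory/GaloisRepresentations/HeckeCharacter.lean` (next to
`HeckeCharacterProofs.lean` and `HeckeCharacterRamificationProofs.lean`).  That module vendors as a
*named fact* `Literature.NumberTheory.GaloisRepresentations.HeckeCharacter.IsNormTwist.isUnramifiedAt`
the statement that a Hecke character `χ` of the number field `K` which is a norm twist
(`χ = ‖·‖^z` for some `z ∈ ℂ`, `HeckeCharacter.IsNormTwist`) is unramified at every finite place
`v` (`HeckeCharacter.IsUnramifiedAt`: the local component `χ_v = χ ∘ localUnits v` is trivial on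
`𝒪_vˣ`).  This file **discharges that fact**
(`Literature.NumberTheory.GaloisRepresentations.HeckeCharacter.IsNormTwist.isUnramifiedAt_holds`),
with no input beyond Mathlib and the sibling file.

The argument is the printed one.  Tate (1950) = Cassels–Fröhlich, Ch. XV: in §2.3 (p. 311) a
quasi-character of a local field `k*` is *unramified* if it is trivial on `u = {α : |α| = 1}`, and
Lemma 2.3.1 begins "For any `s`, `|α|^s` is obviously an unramified quasi-character"; globally
(§4.1, §4.3) the idele norm is the product of the local absolute values, `|𝔞| = ∏_𝔭 |𝔞_𝔭|_𝔭`, so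
its restriction along `K_vˣ ↪ 𝕀_K` is `|·|_v`, which is `1` on `𝒪_vˣ`.  Formally:

* `ideleNorm_localUnits` — `‖localUnits v u‖ = ‖u‖_v` (all other local factors of
  `Literature.NumberTheory.GaloisRepresentations.ideleNorm` are `‖1‖ = 1`);
* `norm_coe_adicCompletionIntegers_units` — `‖u‖_v = 1` for `u ∈ 𝒪_vˣ` (Mathlib
  `adicCompletionIntegers.isUnit_iff_valued_eq_one` and `FinitePlace.norm_def`);
* `IsNormTwist.isUnramifiedAt_holds` — hence `χ_v(u) = ‖localUnits v u‖^z = 1^z = 1`.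

## References

* J. Tate, *Fourier analysis in number fields and Hecke's zeta-functions* (thesis, 1950), in
  Cassels–Fröhlich, *Algebraic Number Theory* (1967), Ch. XV, §2.3, Lemma 2.3.1 (p. 311); §4.3.
  [TateThesis1967]
* J. Neukirch, *Algebraic Number Theory*, Ch. VII §6, (6.10)–(6.11).

## Mathlib

`NumberField.FinitePlace.norm_def`, `IsDedekindDomain.HeightOneSpectrum.adicCompletionIntegers.
isUnit_iff_valued_eq_one`, `finprod_eq_single`, `Complex.one_cpow` are used as is; `localUnits`,
`finiteAdeleSingle_apply_of_ne`, `localUnits_snd_apply_self`, `ideleNorm`, `localComponent` come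
from the sibling file.
-/

noncomputable section

open NumberField IsDedekindDomain

namespace Literature.NumberTheory.GaloisRepresentations

universe u

variable {K : Type u} [Field K] [NumberField K]

/-- The `v`-adic norm of a unit of `𝒪_v` is `1` (`‖u‖_v = q_v^{-v(u)}` and `v(u) = 0`).
Ref: Neukirch, *Algebraic Number Theory*, Ch. II §3 (units of a valuation ring). [folklore] -/
theorem norm_coe_adicCompletionIntegers_units (v : HeightOneSpectrum (𝓞 K))
    (u : (v.adicCompletionIntegers K)ˣ) :
    ‖((u : v.adicCompletionIntegers K) : v.adicCompletion K)‖ = 1 := by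
  rw [NumberField.FinitePlace.norm_def,
    HeightOneSpectrum.adicCompletionIntegers.isUnit_iff_valued_eq_one.mp u.isUnit, map_one,
    NNReal.coe_one]

/-- **The idele norm restricted to `K_vˣ` is the local absolute value**: for the idele
`localUnits v u = (…, 1, u, 1, …)` one has `‖localUnits v u‖ = ‖u‖_v`, every other local factor
being `‖1‖ = 1`.  Ref: Tate (1950), §4.1/§4.3 (`|𝔞| = ∏_𝔭 |𝔞_𝔭|_𝔭`); Neukirch, Ch. VI §1.
[cite: TateThesis1967, §4.3] -/
theorem ideleNorm_localUnits (v : HeightOneSpectrum (𝓞 K)) (u : (v.adicCompletion K)ˣ) :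
    ideleNorm (localUnits v u) = ‖(u : v.adicCompletion K)‖ := by
  unfold ideleNorm
  rw [finprod_eq_single _ v fun w hw => by
      rw [show ((localUnits v u : ideleGroup K) : AdeleRing (𝓞 K) K).2 w = 1 from
        finiteAdeleSingle_apply_of_ne _ hw, norm_one],
    localUnits_snd_apply_self, localUnits_fst,
    Finset.prod_eq_one fun w _ => by
      rw [show (1 : InfiniteAdeleRing K) w = 1 from rfl, norm_one, one_pow],
    one_mul]

/-- The idele norm is trivial on the local units `𝒪_vˣ ↪ 𝕀_K`: `‖localUnits v u‖ = 1` for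
`u ∈ 𝒪_vˣ`.  Ref: Tate (1950), §2.3 (`|·|` is trivial on `u`) with §4.3. [cite: TateThesis1967, §2.3] -/
theorem ideleNorm_localUnits_unitsMap (v : HeightOneSpectrum (𝓞 K))
    (u : (v.adicCompletionIntegers K)ˣ) :
    ideleNorm (localUnits v (Units.map ((v.adicCompletionIntegers K).subtype : _ →* _) u)) = 1 := by
  rw [ideleNorm_localUnits]
  exact norm_coe_adicCompletionIntegers_units v u

namespace HeckeCharacter

/-- **Norm twists are unramified everywhere** — discharge of the named fact
`HeckeCharacter.IsNormTwist.isUnramifiedAt`: if `χ(x) = ‖x‖^z` for all ideles `x`, then for every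
finite place `v` and every `u ∈ 𝒪_vˣ`, `χ_v(u) = ‖localUnits v u‖^z = 1^z = 1`.  This is the
"obvious" half of Tate's Lemma 2.3.1 ("For any `s`, `|α|^s` is obviously an unramified
quasi-character"), transported to `𝕀_K` through `|𝔞| = ∏_𝔭 |𝔞_𝔭|_𝔭` (§4.3).
Ref: Tate (1950), in Cassels–Fröhlich (1967), Ch. XV, §2.3, Lemma 2.3.1 (p. 311); Neukirch,
*Algebraic Number Theory*, Ch. VII §6, (6.10). [cite: TateThesis1967, Lemma 2.3.1] -/
theorem IsNormTwist.isUnramifiedAt_holds : IsNormTwist.isUnramifiedAt (K := K) := by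
  intro χ hχ v u
  obtain ⟨z, hz⟩ := hχ
  have h := hz (localUnits v (Units.map ((v.adicCompletionIntegers K).subtype : _ →* _) u))
  rw [ideleNorm_localUnits_unitsMap, Complex.ofReal_one, Complex.one_cpow] at h
  exact Units.val_eq_one.mp h

end HeckeCharacter

end Literature.NumberTheory.GaloisRepresentations
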